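import Mathlib
import HarnessLib
import Literature.NumberTheory.Transcendental.KZCalculus
import Literature.NumberTheory.Transcendental.KZLogCalculusProofs
import Literature.NumberTheory.Transcendental.KZGroundingRelations
import Literature.NumberTheory.Transcendental.KZProductIdeal
import Literature.NumberTheory.Transcendental.MZVSimplexRep
import Literature.NumberTheory.Transcendental.SemialgebraicMapsProofs
import Literature.MeasureTheory.Lebesgue.PolynomialZeroSet

/-!
# `ArrangementNormalForm` (stmt-KontsevichZagierPeriods-3915), line `janus-bands`, stub `stub_unletter` — definitions

Support file for `stub_unletter` (Janus band representations of base dimension `0` are congruent,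
modulo `KZ.relations`, to `ℤ`-combinations of LETTERED ORDER CELLS).  The normal form of the whole
argument is a representation on the open ordered simplex
`Δ_w = KZ.openOrderedSimplex w = {1 > t₀ > ⋯ > t_{w-1} > 0}` with integrand
`cint G a t = G(t) · ∏ᵢ lett (a i) (tᵢ)` (`G` a polynomial over `ℚ`, `a i : Option ℚ` an optional
simple constant letter, `lett (some c) x = 1/(x - c)`, `lett none x = 1`); the letters are ADMISSIBLE
(`Adm`) when none lies in `(0, 1)`, the top coordinate `t₀` is not lettered `1` and the bottom
coordinate `t_{w-1}` is not lettered `0`.  All helper declarations live in the sub-namespace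
`…JanusBands.Unletter`.

This file: the DEFINITIONS only (reviewed once): letter factors `den`, `lett`, `denPoly`, the class
integrand `cint`, the admissible letter assignments `Adm` (a set), the domination bounds `Kb`, `epsOf`,
`betaF`, the formal primitive `antider`, the target generator set `JwSet` (verbatim the `Jw` of the
stub), the working subgroup `RS = closure JwSet ⊔ KZ.relations`, the class `OC w` of admissible
lettered simplex representations, the order-cell description `loIdx`/`hiIdx` of the simplex, the
neighbours `loP`/`upP` of an inserted coordinate and the relabelling `moveLast`, the PATTERN data of
a bounded order cell (`glo`, `gd`, `nmap`, `nmapInv`, `piece`, `nmat`, `nlin`, `excSet`), and the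
transport `castRep` along `0 + k = k`.  No junk values: `lett (some c) c = 1/0 = 0` is Mathlib's
convention and only ever evaluated off the letter.

References: M. Kontsevich, D. Zagier, *Periods* (2001), §1.2; D. Zagier, *Values of zeta functions
and their applications* (1994), §9 (convergence of iterated integrals).
-/

noncomputable section

open Set MeasureTheory MvPolynomial
open Literature.NumberTheory.Transcendental
open Literature.ModelTheory.ExponentialFields (IsSemialgebraic)

namespace Summit.KontsevichZagierPeriods.ArrangementNormalForm.JanusBands

/-- Registered support goal of this file (a pure measure-theoretic statement): a one-variable
function which is integrable on a box as a function of one coordinate is integrable on the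
corresponding side (`Measure.pi_map_eval`). -/
theorem unletter_integrableOn_pi (w : ℕ) (I : Fin w → Set ℝ) (i₀ : Fin w) (g : ℝ → ℝ) (hg : Measurable g) (h0 : ∀ j, MeasureTheory.volume (I j) ≠ 0) (htop : ∀ j, MeasureTheory.volume (I j) ≠ ⊤) (h : MeasureTheory.IntegrableOn (fun z : Fin w → ℝ => g (z i₀)) (Set.pi Set.univ I)) : MeasureTheory.IntegrableOn g (I i₀) := by
  classical
  rw [IntegrableOn, volume_pi, Measure.restrict_pi_pi] at h
  have h' : Integrable g (Measure.map (Function.eval i₀)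
      (Measure.pi fun j => volume.restrict (I j))) := by
    rw [integrable_map_measure hg.aestronglyMeasurable (measurable_pi_apply i₀).aemeasurable]
    exact h
  rw [Measure.pi_map_eval] at h'
  rw [IntegrableOn, ← integrable_smul_measure (c := ∏ j ∈ Finset.univ.erase i₀,
    volume.restrict (I j) univ) ?_ ?_]
  · exact h'
  · simp only [Measure.restrict_apply_univ]
    exact Finset.prod_ne_zero_iff.2 fun j _ => h0 j
  · simp only [Measure.restrict_apply_univ]
    exact ENNReal.prod_ne_top fun j _ => htop j

namespace Unletter

/-- Denominator of an optional simple letter: `x - c` for the letter `c`, `1` without letter. -/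
def den (o : Option ℚ) (x : ℝ) : ℝ := o.elim 1 fun c => x - (c : ℝ)

/-- The letter factor `1 / den o x`, i.e. `1/(x - c)` or `1`. -/
def lett (o : Option ℚ) (x : ℝ) : ℝ := 1 / den o x

/-- The denominator polynomial `∏ᵢ den (a i) (Xᵢ)` (rational coefficients). -/
def denPoly {w : ℕ} (a : Fin w → Option ℚ) : MvPolynomial (Fin w) ℚ :=
  ∏ i, (a i).elim 1 fun c => X i - C c

/-- The class integrand `G(t) · ∏ᵢ lett (a i) (tᵢ)`. -/
def cint {w : ℕ} (G : MvPolynomial (Fin w) ℚ) (a : Fin w → Option ℚ) (t : Fin w → ℝ) : ℝ :=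
  aeval t G * ∏ i, lett (a i) (t i)

/-- ADMISSIBLE letter data on `Δ_w` (a set of letter assignments): no letter in `(0, 1)`, the top
coordinate (index `0`) is not lettered `1`, the bottom coordinate (index `w - 1`) is not lettered `0`. -/
def Adm (w : ℕ) : Set (Fin w → Option ℚ) :=
  {a | ∀ i c, a i = some c → (c ≤ 0 ∨ 1 ≤ c) ∧ ((i : ℕ) = 0 → c ≠ 1) ∧ ((i : ℕ) + 1 = w → c ≠ 0)}

/-- The bound attached to a letter: `1`, or `max 1 (1/(-c)) (1/(c-1))`. -/
def Kb (o : Option ℚ) : ℝ := o.elim 1 fun c => max 1 (max (1 / (-(c : ℝ))) (1 / ((c : ℝ) - 1)))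

/-- The MZV letter pattern dominating admissible data in dimension `w ≥ 2`: `ω₁` at the bottom,
`ω₀` at the top, and in between `ω₁` exactly for the letters `≥ 1`. -/
def epsOf {w : ℕ} (a : Fin w → Option ℚ) (j : ℕ) : Bool :=
  if h : j < w then
    (if j + 1 = w then true else if j = 0 then false else (a ⟨j, h⟩).elim false fun c => decide (1 ≤ c))
  else false

/-- The formal primitive of `H` along the last variable: `∑ₘ cₘ/(m_last + 1) · X^(m + e_last)`. -/
def antider {n : ℕ} (H : MvPolynomial (Fin (n + 1)) ℚ) : MvPolynomial (Fin (n + 1)) ℚ :=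
  ∑ m ∈ H.support, monomial (m + Finsupp.single (Fin.last n) 1)
    (coeff m H / ((m (Fin.last n) : ℚ) + 1))

/-- The lower bound of a letter factor on `(0, 1)` away from the letter. -/
def betaF (o : Option ℚ) : ℝ := o.elim 1 fun c => 1 / (1 + |(c : ℝ)|)

/-- The target generator set `Jw` of the stub (lettered order cells), verbatim. -/
def JwSet : Set KZ.FormalRep :=
  {w : KZ.FormalRep | ∃ (k : ℕ) (s : KZ.IntegralRep k) (q : ℚ) (a : Fin k → ℚ)
    (lo hi : Fin k → Fin k ⊕ ℚ), Bornology.IsBounded s.domain ∧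
    s.domain = {z | ∀ i, Sum.elim z (fun c => (c : ℝ)) (lo i) < z i ∧
      z i < Sum.elim z (fun c => (c : ℝ)) (hi i)} ∧
    EqOn s.integrand (fun z => (q : ℝ) * ∏ i, 1 / (z i - (a i : ℝ))) s.domain ∧ w = KZ.of s}

/-- The subgroup of formal combinations congruent modulo `KZ.relations` to the span of `JwSet`. -/
def RS : AddSubgroup KZ.FormalRep := AddSubgroup.closure JwSet ⊔ KZ.relations

/-- The CLASS of admissible lettered simplex representations of dimension `w`. -/
def OC (w : ℕ) : Set KZ.FormalRep :=
  {x | ∃ (s : KZ.IntegralRep w) (G : MvPolynomial (Fin w) ℚ) (a : Fin w → Option ℚ),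
    a ∈ Adm w ∧ s.domain = KZ.openOrderedSimplex w ∧
    EqOn s.integrand (cint G a) (KZ.openOrderedSimplex w) ∧ x = KZ.of s}

/-- The simplex is an order cell: lower bounds (next coordinate, or the constant `0`). -/
def loIdx (w : ℕ) (i : Fin w) : Fin w ⊕ ℚ :=
  if h : (i : ℕ) + 1 < w then Sum.inl ⟨i + 1, h⟩ else Sum.inr 0

/-- The simplex is an order cell: upper bounds (previous coordinate, or the constant `1`). -/
def hiIdx (w : ℕ) (i : Fin w) : Fin w ⊕ ℚ :=
  if h : (i : ℕ) = 0 then Sum.inr 1 else Sum.inl ⟨(i : ℕ) - 1, by omega⟩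

/-- The lower neighbour of position `u`, as a polynomial in the remaining coordinates. -/
def loP {n : ℕ} (u : Fin (n + 1)) : MvPolynomial (Fin n) ℚ :=
  if h : (u : ℕ) < n then X ⟨u, h⟩ else 0

/-- The upper neighbour of position `u`, as a polynomial in the remaining coordinates. -/
def upP {n : ℕ} (u : Fin (n + 1)) : MvPolynomial (Fin n) ℚ :=
  if h : (u : ℕ) = 0 then 1 else X ⟨(u : ℕ) - 1, by omega⟩

/-- The relabelling of `Fin (n + 1)` moving position `u` to the last place (order of the other
positions preserved). -/
def moveLast {n : ℕ} (u : Fin (n + 1)) : Fin (n + 1) ≃ Fin (n + 1) :=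
  (finSuccEquiv' u).trans (finSuccEquiv' (Fin.last n)).symm

/-- Transport of a representation along an equality of dimensions. -/
def castRep {a b : ℕ} (h : a = b) (s : KZ.IntegralRep a) : KZ.IntegralRep b := h ▸ s

section Patterns

variable {k M : ℕ} (κ : Fin (M + 1) ↪o ℚ)

/-- Lower end of the gap `(κ_{r i}, κ_{r i + 1})` assigned to the coordinate `i`. -/
def glo (r : Fin k → Fin M) (i : Fin k) : ℚ := κ (Fin.castSucc (r i))

/-- Width of the gap assigned to the coordinate `i`. -/
def gd (r : Fin k → Fin M) (i : Fin k) : ℚ := κ (Fin.succ (r i)) - κ (Fin.castSucc (r i))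

/-- The normalising affine map of the pattern `(r, σ)`: rescale every gap onto `(0, 1)` and list the
coordinates in the order `σ`. -/
def nmap (r : Fin k → Fin M) (σ : Equiv.Perm (Fin k)) (z : Fin k → ℝ) : Fin k → ℝ :=
  fun j => (z (σ j) - glo κ r (σ j)) / gd κ r (σ j)

/-- The inverse affine map. -/
def nmapInv (r : Fin k → Fin M) (σ : Equiv.Perm (Fin k)) (y : Fin k → ℝ) : Fin k → ℝ :=
  fun i => glo κ r i + gd κ r i * y (σ.symm i)

/-- The PIECE of the pattern `(r, σ)`: the points sent into the simplex by `nmap`. -/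
def piece (r : Fin k → Fin M) (σ : Equiv.Perm (Fin k)) : Set (Fin k → ℝ) :=
  nmap κ r σ ⁻¹' KZ.openOrderedSimplex k

/-- The matrix of the linear part of `nmap`. -/
def nmat (r : Fin k → Fin M) (σ : Equiv.Perm (Fin k)) : Matrix (Fin k) (Fin k) ℝ :=
  (Matrix.diagonal fun i => ((gd κ r i : ℝ))⁻¹).submatrix σ id

/-- The linear part of `nmap`. -/
def nlin (r : Fin k → Fin M) (σ : Equiv.Perm (Fin k)) : (Fin k → ℝ) →L[ℝ] (Fin k → ℝ) :=
  LinearMap.toContinuousLinearMap (Matrix.toLin' (nmat κ r σ))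

/-- The exceptional set of the dissection: coordinates equal to a constant, or two coordinates with
equal rescaled values. -/
def excSet (k M : ℕ) (κ : Fin (M + 1) ↪o ℚ) : Set (Fin k → ℝ) :=
  (⋃ i : Fin k, ⋃ j : Fin (M + 1), {z | z i = κ j}) ∪
    ⋃ r : Fin k → Fin M, ⋃ i : Fin k, ⋃ i' : Fin k,
      {z | i ≠ i' ∧ (z i - glo κ r i) / gd κ r i = (z i' - glo κ r i') / gd κ r i'}

end Patterns

end Unletter

end Summit.KontsevichZagierPeriods.ArrangementNormalForm.JanusBands
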